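/-
Copyright (c) 2026 the pub-hodgecm-mathlib formalisation cell (harness21).  Prover seat hodgecm-mathlib-LH4-p13 (g6), req620 Track A «(D-RAM) FOUR-FRAME» squad, unit U2H:
the (ρ2b′-X) child `stub_U2H_fixedPointCensus_typeTwo_unit0` (U2H :418) — BRIDGE between the (D3) TOP BIT of ★ T5b `…ToricLevelCensusRamKTop` (F0P3-p01 (g32), sheet v5:
`∃ ω₁, |1 + (ρh∕h)∕(ρμ∕μ)·t(ω₁)| ≤ exp(−c)`) and the NORM-DECOMPOSITION letters `z = x·Θx·e·w` of ★ p857764 ∕ p857819 (this seat, S6b-RK ∕ S9-R) and of T5b sheet v4 (D3).  2026-09-04.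
-/
import Summits.HodgeConjecture.HodgeConjecture.Theorems.F0P3cDyRamTokenRealizabilityRamK   -- ★ p857764 (this seat): `hyperbolic_alive_of_alive_of_two_mul_le` (the ε = −1 window); brings `v_varpi_pow`
import Literature.NumberTheory.LocalFields.QuadraticOrderThetaFixedUnits                  -- ★ p857302 (F0P3-p01 (g32)): `exists_fixed_mul_near_one_iff_mem_order` (`𝒪_cˣ = 𝒪_Eˣ·U^{(c)}`)
import HarnessLib

/-!
# Crux `H413`, line LH4 «(D-RAM) FOUR-FRAME» — unit U2H, (ρ2b′-X): the (D3) TOP BIT ⟺ «`z = xΘx·e·w`» (any `Θ`-fixed side scalar), and THE `ε = −1` WINDOW IN BIT LETTERS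

Cell `hodgecm-mathlib` (D-0151), FLOOR 0, crux item H413 = `stmt-HodgeConjecture-24833`, route of record `HCCMUnconditional`; squad F0∕P3c∕LH4; registered stub served:
`F0P3cDyRamFourFrameU2H.stub_U2H_fixedPointCensus_typeTwo_unit0` ((ρ2b′-X), U2H :418) through LH4-p14's HEAD-OF-ORGANS, RK branch of the (C0) census.  THEOREMS ONLY (no `def`,
no instance, no notation, no `sorry`); lane `--supports stmt-HodgeConjecture-24833` (count-neutral).

WHY.  F0P3-p01 (g32)'s (D3) leaf `ncard_levelSetDep_top_eq_ite` ∕ `ncard_levelSetDep_top_mul_eq_of_ramK` (REPORT-FIRST 06:08Z) prints the diagonal top count as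
`[B_{(s₀)} : 𝒪_jˣ]·BIT` with the honest token **`BIT(h, μ, c) := ∃ ω₁ ∈ 𝒪_Mˣ, |1 + (ρh∕h)∕(ρμ∕μ)·ρ(ω₁Θω₁)∕(ω₁Θω₁)| ≤ exp(−c)`** («its evaluation per cell is the payer's diagonal
rule» — OPEN), while this seat's S6b-RK window (★ p857764 (4)) and S9-R side law (★ p857819 §4–§5) speak the sheet-v4 letters **`z = x·Θx·e·w`** for the unit
`z := μ·h·(α − ρα)∕π` (`π` a `ρ`-fixed scalar, e.g. `ϖE^n`).  §1 proves the two are EQUIVALENT for every `Θ`-fixed `h ≠ 0` and `c ≥ 1` (`topBit_iff_exists_norm_decomp`):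
with `η = ρh∕h`, `κ = ρμ∕μ`, `t(ω) = ρN(ω)∕N(ω)`, `N(ω) = ωΘω`, the relations `μhα⁻ = πz`, `ρμ·ρh·α⁻ = −π·ρz` give `ρz·μ·h = −z·ρh·ρμ`; for `x := ω₁·h₀` (`h₀ = h·(ϖEΘϖE)^n` the unit
part of `h`, even valuation) the unit `V := z∕(xΘx)` has `ρV = −V∕Q`, `Q = η·t(ω₁)∕κ`, so `|V − ρV| = |1 + Q| ≤ exp(−c)` and `V ∈ 𝒪_cˣ = 𝒪_Eˣ·U^{(c)}` (★ (M-RK1) §1); conversely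
`z = xΘx·e·w` gives `Q(x∕h₀) = −w∕ρw`.  §2 restates the `ε = −1` WINDOW of ★ p857764 in BIT letters (`topBit_hyper_of_topBit_of_two_mul_le`): for the hyperbolic scalar
`ρh = −h` and ANY `Θ`-fixed `h′` (the other line model), `2d ≤ ℓ + 1 ∧ BIT(h′, μ, c) ⇒ BIT(h, μ, c)` — at far cells outside the window the − side never lives alone.
INTERFACE.  Frame letters = ★ T5b (D3) generic (`hρρ hvρ hΘΘ hΘρ hvΘ hα1 hα hρϖE hϖE`) + the RamK datum clause `hΘev` (Θ-fixed ⇒ even valuation) + (§2) the type-RamK letters of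
★ p857764 (`αK` Θ-fixed unramified generator, `hNF`, `hNd`).  `z` is bound by the EQUATION `μ·h·(α − ρα) = π·z` (no division in the statement).
HONEST LABEL.  Count-neutral helper; (ρ2b′-X) OPEN; `HC_CM` is proved only modulo the 7 printed citations (2 remaining named inputs: hLiu418 = `stmt-HodgeConjecture-24832`, h413 =
`stmt-HodgeConjecture-24833`) until rung 0 closes.

## References
* [Jacobowitz1962] R. Jacobowitz, *Hermitian forms over local fields*, Amer. J. Math. 84 (1962), §4.
* [Serre1979] J.-P. Serre, *Local Fields*, GTM 67 (1979), Ch. III §6 Prop. 12; Ch. V §1, §3 Cor. 3; Ch. X §1.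
* [Flicker1998UnitaryFL] Y. Z. Flicker, *Elementary proof of the fundamental lemma for a unitary group*, Canad. J. Math. 50 (1998), Prop. 7 p. 84.
* [Kottwitz1986BaseChangeUnits] R. E. Kottwitz, *Base change for unit elements of Hecke algebras*, Compositio Math. 60 (1986), §1 pp. 240–241.
-/

set_option autoImplicit false

open WithZero

namespace Summit.HodgeConjecture.HodgeConjecture.Cruxes.H413.F0P3cDyRamTopBitNormBridge

open Literature.NumberTheory.LocalFields.QuadraticOrder (exists_fixed_mul_near_one_iff_mem_order)
open Literature.NumberTheory.LocalFields.WildQuadraticDatum (v_varpi_pow)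
open Summit.HodgeConjecture.HodgeConjecture.Cruxes.H413.F0P3cDyRamTokenRealizabilityRamK (hyperbolic_alive_of_alive_of_two_mul_le)

variable {K : Type*} [Field K] [Valued K ℤᵐ⁰]

/-! ## §1 BIT ⟺ norm decomposition -/

/-- **THE (D3) TOP BIT ⟺ «`z = x·Θx·e·w`».**  Frame: `ρ, Θ` commuting involutions, isometric; `ϖE` a `ρ`-fixed uniformiser; `Θ`-fixed non-zero elements of even valuation (RamK
datum); `α` integral with `|α − ρα| = 1` (`M∕E` unramified).  Data: a `Θ`-fixed side scalar `h ≠ 0`, `μ ≠ 0`, a `ρ`-fixed `π ≠ 0` and the UNIT `z` with `μ·h·(α − ρα) = π·z`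
(the unit part of `μh(α − ρα)`), a depth `c ≥ 1`.  Then
`(∃ ω₁ ∈ 𝒪_Mˣ, |1 + (ρh∕h)∕(ρμ∕μ)·ρ(ω₁Θω₁)∕(ω₁Θω₁)| ≤ exp(−c)) ↔ (∃ x e w, |x| = 1 ∧ ρe = e ∧ |e| = 1 ∧ |w − 1| ≤ exp(−c) ∧ z = xΘx·e·w)` — F0P3-p01 (g32)'s sheet-v5 bit
versus the sheet-v4 ∕ ★ p857764 ∕ ★ p857819 decomposition, for BOTH line models. [cite: Jacobowitz1962, §4] [cite: Serre1979, Ch. III §6 Prop. 12; Ch. X §1]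
[cite: Kottwitz1986BaseChangeUnits, §1 pp. 240–241] -/
theorem topBit_iff_exists_norm_decomp {ρ Θ : K →+* K} (hρρ : ∀ x, ρ (ρ x) = x) (hΘΘ : ∀ x, Θ (Θ x) = x) (hρΘ : ∀ x, ρ (Θ x) = Θ (ρ x))
    (hρv : ∀ x, Valued.v (ρ x) = Valued.v x) (hΘv : ∀ x, Valued.v (Θ x) = Valued.v x)
    {ϖE : K} (hϖE : Valued.v ϖE = exp (-1 : ℤ)) (hρϖ : ρ ϖE = ϖE)
    (hΘev : ∀ x : K, Θ x = x → x ≠ 0 → ∃ n : ℤ, Valued.v x = exp (2 * n))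
    {α : K} (hα1 : Valued.v α ≤ 1) (hαρ : Valued.v (α - ρ α) = 1)
    {h μ π z : K} (hΘh : Θ h = h) (hh : h ≠ 0) (hμ0 : μ ≠ 0) (hρπ : ρ π = π) (hπ0 : π ≠ 0)
    (hzdef : μ * h * (α - ρ α) = π * z) (hz1 : Valued.v z = 1) {c : ℕ} (hc : 1 ≤ c) :
    (∃ ω₁ : Kˣ, Valued.v (ω₁ : K) = 1 ∧ Valued.v (1 + ρ h / h / (ρ μ / μ) * (ρ ((ω₁ : K) * Θ ω₁) / ((ω₁ : K) * Θ ω₁))) ≤ exp (-(c : ℤ))) ↔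
      ∃ x e w : K, Valued.v x = 1 ∧ ρ e = e ∧ Valued.v e = 1 ∧ Valued.v (w - 1) ≤ exp (-(c : ℤ)) ∧ z = x * Θ x * e * w := by
  -- ## frame bookkeeping
  have hαne : ρ α ≠ α := fun h0 => by rw [h0, sub_self, map_zero] at hαρ; exact zero_ne_one hαρ
  have hα0 : α - ρ α ≠ 0 := sub_ne_zero.2 (Ne.symm hαne)
  have hint : ∀ y : K, Valued.v y ≤ 1 → Valued.v ((y - ρ y) / (α - ρ α)) ≤ 1 := by
    intro y hy
    rw [map_div₀, hαρ, div_one]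
    exact (Valuation.map_sub _ _ _).trans (max_le hy (by rw [hρv]; exact hy))
  have hϖc : Valued.v (ϖE ^ c * (α - ρ α)) = exp (-(c : ℤ)) := by
    rw [Valuation.map_mul, Valuation.map_pow, hαρ, mul_one, v_varpi_pow hϖE]
  have hρh0 : ρ h ≠ 0 := (map_ne_zero ρ).2 hh
  have hρμ0 : ρ μ ≠ 0 := (map_ne_zero ρ).2 hμ0
  have hz0 : z ≠ 0 := fun h0 => by rw [h0, map_zero] at hz1; exact zero_ne_one hz1
  -- `ρ z`, and the key relation `ρz·μ·h = −z·ρh·ρμ`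
  have hρz : ρ μ * ρ h * (α - ρ α) = -(π * ρ z) := by
    have h1 := congrArg ρ hzdef
    rw [map_mul, map_mul, map_sub, hρρ, map_mul, hρπ] at h1
    linear_combination -h1
  have hkey : ρ z * μ * h + z * ρ h * ρ μ = 0 := by
    have h1 : π * (ρ z * μ * h + z * ρ h * ρ μ) = 0 := by linear_combination (μ * h) * hρz + (-(ρ h * ρ μ)) * hzdef
    exact (mul_eq_zero.1 h1).resolve_left hπ0
  have hρzeq : ρ z = -(z * ρ h * ρ μ) / (μ * h) := by
    rw [eq_div_iff (mul_ne_zero hμ0 hh)]; linear_combination hkey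
  -- the `F`-element `π₂ = ϖE·ΘϖE` and the unit part `h₀ = h·π₂^n` of `h`
  set π₂ := ϖE * Θ ϖE with hπ₂
  have hρπ₂ : ρ π₂ = π₂ := by rw [hπ₂, map_mul, hρϖ, hρΘ, hρϖ]
  have hΘπ₂ : Θ π₂ = π₂ := by rw [hπ₂, map_mul, hΘΘ, mul_comm]
  have hvπ₂ : Valued.v π₂ = exp (-2 : ℤ) := by rw [hπ₂, Valuation.map_mul, hΘv, hϖE, ← exp_add]; rfl
  have hπ₂0 : π₂ ≠ 0 := fun h0 => by rw [h0, map_zero] at hvπ₂; exact (exp_ne_zero hvπ₂.symm).elim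
  obtain ⟨n, hn⟩ := hΘev h hΘh hh
  set h₀ := h * π₂ ^ n with hh₀
  have hΘh₀ : Θ h₀ = h₀ := by rw [hh₀, map_mul, map_zpow₀, hΘh, hΘπ₂]
  have hρh₀ : ρ h₀ = ρ h * π₂ ^ n := by rw [hh₀, map_mul, map_zpow₀, hρπ₂]
  have hvh₀ : Valued.v h₀ = 1 := by
    rw [hh₀, Valuation.map_mul, map_zpow₀, hn, hvπ₂, ← exp_zsmul, ← exp_add, ← exp_zero]
    congr 1; simp only [smul_eq_mul]; ring
  have hh₀0 : h₀ ≠ 0 := fun h0 => by rw [h0, map_zero] at hvh₀; exact zero_ne_one hvh₀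
  have hπn0 : π₂ ^ n ≠ 0 := zpow_ne_zero n hπ₂0
  constructor
  · ---------------------------------------------------------------- BIT ⟹ decomposition
    rintro ⟨ω₁, hω₁, hbit⟩
    have hω0 : (ω₁ : K) ≠ 0 := ω₁.ne_zero
    have hΘω0 : Θ (ω₁ : K) ≠ 0 := (map_ne_zero Θ).2 hω0
    have hN0 : (ω₁ : K) * Θ ω₁ ≠ 0 := mul_ne_zero hω0 hΘω0
    have hρN0 : ρ ((ω₁ : K) * Θ ω₁) ≠ 0 := (map_ne_zero ρ).2 hN0
    have hvN : Valued.v ((ω₁ : K) * Θ ω₁) = 1 := by rw [Valuation.map_mul, hΘv, hω₁, mul_one]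
    -- `x := ω₁·h₀`, `V := z ∕ (xΘx)`
    set x := (ω₁ : K) * h₀ with hx
    have hxΘx : x * Θ x = (ω₁ : K) * Θ ω₁ * h₀ ^ 2 := by rw [hx, map_mul, hΘh₀]; ring
    have hvx : Valued.v x = 1 := by rw [hx, Valuation.map_mul, hω₁, hvh₀, mul_one]
    have hxx0 : x * Θ x ≠ 0 := by rw [hxΘx]; exact mul_ne_zero hN0 (pow_ne_zero 2 hh₀0)
    have hvxx : Valued.v (x * Θ x) = 1 := by rw [Valuation.map_mul, hΘv, hvx, mul_one]
    set Q := ρ h / h / (ρ μ / μ) * (ρ ((ω₁ : K) * Θ ω₁) / ((ω₁ : K) * Θ ω₁)) with hQ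
    have hvQ : Valued.v Q = 1 := by
      have hvh0 : Valued.v h ≠ 0 := (Valuation.ne_zero_iff _).2 hh
      have hvμ0 : Valued.v μ ≠ 0 := (Valuation.ne_zero_iff _).2 hμ0
      rw [hQ, Valuation.map_mul, map_div₀, map_div₀, map_div₀, map_div₀, hρv, hρv, hρv, hvN, div_self hvh0, div_self hvμ0]
      norm_num
    have hQ0 : Q ≠ 0 := fun h0 => by rw [h0, map_zero] at hvQ; exact zero_ne_one hvQ
    set V := z / (x * Θ x) with hV
    have hvV : Valued.v V = 1 := by rw [hV, map_div₀, hz1, hvxx, div_one]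
    -- `ρV = −V ∕ Q`
    have hρω0 : ρ (ω₁ : K) ≠ 0 := (map_ne_zero ρ).2 hω0
    have hρΘω0 : ρ (Θ (ω₁ : K)) ≠ 0 := (map_ne_zero ρ).2 hΘω0
    have hρV : ρ V = -V / Q := by
      rw [hV, hQ, hx]
      simp only [map_div₀, map_mul, map_zpow₀, hh₀, hΘh, hΘπ₂, hρπ₂, hρzeq]
      field_simp
    have hVρ : Valued.v (V - ρ V) ≤ exp (-(c : ℤ)) := by
      have h1 : V - ρ V = V * (1 + Q) / Q := by rw [hρV]; field_simp; ring
      rw [h1, map_div₀, Valuation.map_mul, hvV, hvQ, one_mul, div_one]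
      exact hbit
    -- `V ∈ 𝒪_cˣ = 𝒪_Eˣ·U^{(c)}`
    obtain ⟨e, m, hρe, hve, hm, hVem⟩ :=
      (exists_fixed_mul_near_one_iff_mem_order hρρ hρv hαne hα1 hint hρϖ hϖE c hvV).1 ⟨hvV.le, by rw [hϖc]; exact hVρ⟩
    refine ⟨x, e, m, hvx, hρe, hve, hm, ?_⟩
    have h1 : z = x * Θ x * V := by rw [hV, mul_div_cancel₀ _ hxx0]
    rw [h1, hVem]; ring
  · ---------------------------------------------------------------- decomposition ⟹ BIT
    rintro ⟨x, e, w, hvx, hρe, hve, hw, hz⟩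
    have hx0 : x ≠ 0 := fun h0 => by rw [h0, map_zero] at hvx; exact zero_ne_one hvx
    have hΘx0 : Θ x ≠ 0 := (map_ne_zero Θ).2 hx0
    have he0 : e ≠ 0 := fun h0 => by rw [h0, map_zero] at hve; exact zero_ne_one hve
    have hvw : Valued.v w = 1 := by
      have hlt : Valued.v (w - 1) < Valued.v (1 : K) := by
        rw [Valuation.map_one]; exact lt_of_le_of_lt hw (by rw [← exp_zero, exp_lt_exp]; omega)
      have h1 := Valuation.map_add_eq_of_lt_left _ hlt
      rwa [add_sub_cancel, Valuation.map_one] at h1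
    have hw0 : w ≠ 0 := fun h0 => by rw [h0, map_zero] at hvw; exact zero_ne_one hvw
    have hρw0 : ρ w ≠ 0 := (map_ne_zero ρ).2 hw0
    have hρxx0 : ρ (x * Θ x) ≠ 0 := (map_ne_zero ρ).2 (mul_ne_zero hx0 hΘx0)
    -- `ω₁ := x ∕ h₀`
    have hω0 : x * h₀⁻¹ ≠ 0 := mul_ne_zero hx0 (inv_ne_zero hh₀0)
    refine ⟨Units.mk0 (x * h₀⁻¹) hω0, ?_, ?_⟩
    · rw [Units.val_mk0, Valuation.map_mul, map_inv₀, hvx, hvh₀, inv_one, mul_one]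
    · rw [Units.val_mk0]
      have hρz2 : ρ z = ρ (x * Θ x) * e * ρ w := by rw [hz, map_mul, map_mul, hρe]
      have hμeq : μ = π * z / (h * (α - ρ α)) := by
        rw [eq_div_iff (mul_ne_zero hh hα0)]; linear_combination hzdef
      have hρμeq : ρ μ = -(π * ρ z) / (ρ h * (α - ρ α)) := by
        rw [eq_div_iff (mul_ne_zero hρh0 hα0)]; linear_combination hρz
      have hNω : x * h₀⁻¹ * Θ (x * h₀⁻¹) = x * Θ x / h₀ ^ 2 := by rw [map_mul, map_inv₀, hΘh₀]; field_simp
      have hρNω : ρ (x * Θ x / h₀ ^ 2) = ρ (x * Θ x) / (ρ h * π₂ ^ n) ^ 2 := by rw [map_div₀, map_pow, hρh₀]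
      have hQ : 1 + ρ h / h / (ρ μ / μ) * (ρ (x * h₀⁻¹ * Θ (x * h₀⁻¹)) / (x * h₀⁻¹ * Θ (x * h₀⁻¹))) = (ρ w - w) / ρ w := by
        rw [hNω, hρNω, hρμeq, hμeq, hρz2, hz, hh₀]
        field_simp
        ring
      rw [hQ, map_div₀, hρv, hvw, div_one]
      have h1 : ρ w - w = -((w - 1) - ρ (w - 1)) := by rw [map_sub, map_one]; ring
      rw [h1, Valuation.map_neg]
      exact (Valuation.map_sub _ _ _).trans (max_le hw (by rw [hρv]; exact hw))

/-! ## §2 THE `ε = −1` WINDOW IN BIT LETTERS -/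

/-- **THE `ε = −1` WINDOW, BIT FORM.**  Frame as §1 plus the type-RamK letters of ★ p857764: a `Θ`-FIXED integral `αK` with `|αK − ραK| = 1` (unramified third field), the
norm suppliers `hNF` (`𝒪_Fˣ ⊆ N_{M∕K♮}(𝒪_Mˣ)`), `hNd` (`U_{K♮}^{(d)} ⊆ N`), `1 ≤ d`.  Data: `μ` with `|μ| = exp(−m)`, `|μ − ρμ| = exp(−(ℓ + m))` and `2d ≤ ℓ + 1` (outside the
window); the HYPERBOLIC scalar `h` (`Θh = h`, `ρh = −h`) and ANY other `Θ`-fixed scalar `h′`; the units `z, z′` with `μh(α − ρα) = πz`, `μh′(α − ρα) = π′z′` (`π, π′` `ρ`-fixed); a far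
depth `c ≥ 1`.  Then `BIT(h′, μ, c) → BIT(h, μ, c)`: a far cell alive for the other line model is alive for the hyperbolic one — so `ε = −1` (− side alone) forces
`ℓ ≤ 2d − 2`, the window of ★ `toricCensusSum_ramK`. [cite: Serre1979, Ch. V §3 Cor. 3] [cite: Flicker1998UnitaryFL, p. 84] [cite: Jacobowitz1962, §4] -/
theorem topBit_hyper_of_topBit_of_two_mul_le {ρ Θ : K →+* K} (hρρ : ∀ x, ρ (ρ x) = x) (hΘΘ : ∀ x, Θ (Θ x) = x) (hρΘ : ∀ x, ρ (Θ x) = Θ (ρ x))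
    (hρv : ∀ x, Valued.v (ρ x) = Valued.v x) (hΘv : ∀ x, Valued.v (Θ x) = Valued.v x)
    {ϖE : K} (hϖE : Valued.v ϖE = exp (-1 : ℤ)) (hρϖ : ρ ϖE = ϖE)
    (hΘev : ∀ x : K, Θ x = x → x ≠ 0 → ∃ n : ℤ, Valued.v x = exp (2 * n))
    {α : K} (hα1 : Valued.v α ≤ 1) (hαρ : Valued.v (α - ρ α) = 1)
    {αK : K} (hΘαK : Θ αK = αK) (hαK1 : Valued.v αK ≤ 1) (hαKρ : Valued.v (αK - ρ αK) = 1)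
    {d : ℕ} (hd : 1 ≤ d)
    (hNF : ∀ f : K, ρ f = f → Θ f = f → Valued.v f = 1 → ∃ x : K, x * Θ x = f)
    (hNd : ∀ u : K, Θ u = u → Valued.v (u - 1) ≤ Valued.v ϖE ^ (2 * d) → ∃ x : K, x * Θ x = u)
    {μ : K} {m ℓ : ℕ} (hμ : Valued.v μ = exp (-(m : ℤ))) (hμρ : Valued.v (μ - ρ μ) = exp (-((ℓ : ℤ) + m))) (hdℓ : 2 * d ≤ ℓ + 1)
    {h h' π π' z z' : K} (hΘh : Θ h = h) (hρh : ρ h = -h) (hh : h ≠ 0) (hΘh' : Θ h' = h') (hh' : h' ≠ 0)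
    (hρπ : ρ π = π) (hπ0 : π ≠ 0) (hρπ' : ρ π' = π') (hπ'0 : π' ≠ 0)
    (hzdef : μ * h * (α - ρ α) = π * z) (hz1 : Valued.v z = 1) (hz'def : μ * h' * (α - ρ α) = π' * z') (hz'1 : Valued.v z' = 1)
    {c : ℕ} (hc : 1 ≤ c)
    (hbit' : ∃ ω₁ : Kˣ, Valued.v (ω₁ : K) = 1 ∧ Valued.v (1 + ρ h' / h' / (ρ μ / μ) * (ρ ((ω₁ : K) * Θ ω₁) / ((ω₁ : K) * Θ ω₁))) ≤ exp (-(c : ℤ))) :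
    ∃ ω₁ : Kˣ, Valued.v (ω₁ : K) = 1 ∧ Valued.v (1 + ρ h / h / (ρ μ / μ) * (ρ ((ω₁ : K) * Θ ω₁) / ((ω₁ : K) * Θ ω₁))) ≤ exp (-(c : ℤ)) := by
  have hμ0 : μ ≠ 0 := fun h0 => by rw [h0, map_zero] at hμ; exact (exp_ne_zero hμ.symm).elim
  have hα0 : α - ρ α ≠ 0 := fun h0 => by rw [h0, map_zero] at hαρ; exact zero_ne_one hαρ
  have hz0 : z ≠ 0 := fun h0 => by rw [h0, map_zero] at hz1; exact zero_ne_one hz1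
  have hz'0 : z' ≠ 0 := fun h0 => by rw [h0, map_zero] at hz'1; exact zero_ne_one hz'1
  -- ## the other side's decomposition, transported to `z`
  obtain ⟨x, e, w, hvx, hρe, hve, hw, hz'⟩ :=
    (topBit_iff_exists_norm_decomp hρρ hΘΘ hρΘ hρv hΘv hϖE hρϖ hΘev hα1 hαρ hΘh' hh' hμ0 hρπ' hπ'0 hz'def hz'1 hc).1 hbit'
  -- `z = z′·r` with `r := (h ∕ h′)·(π′ ∕ π)`; split `r` into a `Θ`-fixed unit and a `ρ`-fixed unit
  set π₂ := ϖE * Θ ϖE with hπ₂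
  have hρπ₂ : ρ π₂ = π₂ := by rw [hπ₂, map_mul, hρϖ, hρΘ, hρϖ]
  have hΘπ₂ : Θ π₂ = π₂ := by rw [hπ₂, map_mul, hΘΘ, mul_comm]
  have hvπ₂ : Valued.v π₂ = exp (-2 : ℤ) := by rw [hπ₂, Valuation.map_mul, hΘv, hϖE, ← exp_add]; rfl
  have hπ₂0 : π₂ ≠ 0 := fun h0 => by rw [h0, map_zero] at hvπ₂; exact (exp_ne_zero hvπ₂.symm).elim
  have hΘq : Θ (h / h') = h / h' := by rw [map_div₀, hΘh, hΘh']
  obtain ⟨n, hn⟩ := hΘev (h / h') hΘq (div_ne_zero hh hh')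
  set k₁ := h / h' * π₂ ^ n with hk₁
  set e₁ := π' / π * (π₂ ^ n)⁻¹ with he₁
  have hΘk₁ : Θ k₁ = k₁ := by rw [hk₁, map_mul, map_zpow₀, hΘq, hΘπ₂]
  have hvk₁ : Valued.v k₁ = 1 := by
    rw [hk₁, Valuation.map_mul, map_zpow₀, hn, hvπ₂, ← exp_zsmul, ← exp_add, ← exp_zero]
    congr 1; simp only [smul_eq_mul]; ring
  have hρe₁ : ρ e₁ = e₁ := by rw [he₁, map_mul, map_inv₀, map_zpow₀, map_div₀, hρπ, hρπ', hρπ₂]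
  have hzz' : z = z' * (k₁ * e₁) := by
    have h1 : π * z * h' = π' * z' * h := by linear_combination (-h') * hzdef + h * hz'def
    rw [hk₁, he₁]
    field_simp
    linear_combination h1
  have hve₁ : Valued.v e₁ = 1 := by
    have h1 := congrArg Valued.v hzz'
    rw [hz1, Valuation.map_mul, Valuation.map_mul, hz'1, hvk₁, one_mul, one_mul] at h1
    exact h1.symm
  -- «some side alive» for `z`: `z = (xΘx·k₁)·(e·e₁)·w`
  have halive : ∃ k e w : K, Θ k = k ∧ Valued.v k = 1 ∧ ρ e = e ∧ Valued.v e = 1 ∧ Valued.v (w - 1) ≤ exp (-(c : ℤ)) ∧ z = k * e * w := by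
    refine ⟨x * Θ x * k₁, e * e₁, w, ?_, ?_, ?_, ?_, hw, ?_⟩
    · rw [map_mul, map_mul, hΘΘ, hΘk₁, mul_comm (Θ x) x]
    · rw [Valuation.map_mul, Valuation.map_mul, hΘv, hvx, hvk₁, mul_one, mul_one]
    · rw [map_mul, hρe, hρe₁]
    · rw [Valuation.map_mul, hve, hve₁, mul_one]
    · rw [hzz', hz']; ring
  -- `|z − ρz| = exp(−ℓ)` for the hyperbolic scalar
  have hzρ : Valued.v (z - ρ z) ≤ exp (-(ℓ : ℤ)) := by
    have hρz : π * ρ z = ρ μ * h * (α - ρ α) := by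
      have h1 := congrArg ρ hzdef
      rw [map_mul, map_mul, map_sub, hρρ, hρh, map_mul, hρπ] at h1
      linear_combination -h1
    have hdiff : z - ρ z = (μ - ρ μ) * (h * (α - ρ α) / π) := by
      field_simp
      linear_combination -hzdef - hρz
    have hrest : Valued.v (h * (α - ρ α) / π) = exp (m : ℤ) := by
      have h1 : Valued.v μ * Valued.v (h * (α - ρ α) / π) = 1 := by
        rw [← Valuation.map_mul, show μ * (h * (α - ρ α) / π) = z by rw [← mul_div_assoc, div_eq_iff hπ0]; linear_combination hzdef, hz1]
      rw [hμ] at h1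
      rw [eq_inv_of_mul_eq_one_right h1, ← exp_neg, neg_neg]
    rw [hdiff, Valuation.map_mul, hμρ, hrest, ← exp_add]
    rw [exp_le_exp]; omega
  -- the window lemma of ★ p857764, then back to BIT letters
  obtain ⟨x', e', w', hvx', hρe', hve', hw', hzx'⟩ :=
    hyperbolic_alive_of_alive_of_two_mul_le hρρ hρΘ hρv hΘv hϖE hΘαK hαK1 hαKρ hΘev hd hNF hNd hz1 hdℓ hzρ hc halive
  exact (topBit_iff_exists_norm_decomp hρρ hΘΘ hρΘ hρv hΘv hϖE hρϖ hΘev hα1 hαρ hΘh hh hμ0 hρπ hπ0 hzdef hz1 hc).2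
    ⟨x', e', w', hvx', hρe', hve', hw', hzx'⟩

end Summit.HodgeConjecture.HodgeConjecture.Cruxes.H413.F0P3cDyRamTopBitNormBridge
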